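import Summits.MatrixMultiplication.OmegaCensus.STPPSmallPatternT1Order16Hosts
import Summits.MatrixMultiplication.OmegaCensus.STPPSmallPatternT1Below24
import Summits.MatrixMultiplication.OmegaCensus.STPPSmallPatternT2Below24
import Summits.MatrixMultiplication.OmegaCensus.STPPSmallPatternTableWitnessesT2A
import Summits.MatrixMultiplication.OmegaCensus.STPPSmallPatternTableWitnessesT2B

/-!
# ω-census, small STPP patterns: AT THE ONSET ORDERS 12 AND 24 EVERY ABELIAN GROUP HOSTS (kernel, intrinsic onsets)

HONEST FRAMING (pub-omega census; verbatim): lottery ticket; floor = certified bounds/negative ranges.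
Census STRUCTURE bookkeeping of the STPP track (seat pub-omega-stpp-3, gen 25; STRUCTURE row B5: the threshold columns `T1`, `T2` and
their onsets), not progress on `ω`: small patterns in small groups bound no exponent.

The all-abelian onsets `6 / 12 / 16 / 24` of `(2,1,1)^k` (`k = 2, 3, 4, 5`) and `12 / 24 / 32` of `(1,2,2)^k` (`k = 2, 3, 4`) are in
the kernel (`STPPSmallPatternT1OnsetsSmall`, `…T1Below24`, `…T2Below24`, `…T2Onset32`), each as «no host below, one host at».  At the
orders `16` (`(2,1,1)⁴`) and `32` (`(1,2,2)⁴`) the host list is PROPER (cyclic and elementary abelian excluded: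
`STPPSmallPatternT1Order16Hosts`, `…T2Order32Hosts`).  This file shows that at the onset orders `12` and `24` the host list is ALL
types, so that the onsets become INTRINSIC equivalences:

* `exists_isSTPP_211pow3_of_card_12`, `exists_isSTPP_122pow2_of_card_12` — every abelian group of order `12` hosts `(2,1,1)³` and `(1,2,2)²`;
* `exists_isSTPP_211pow5_of_card_24`, `exists_isSTPP_122pow3_of_card_24` — every abelian group of order `24` hosts `(2,1,1)⁵` and `(1,2,2)³`;
* `stpp211pow3_iff_card_eq_12`, `stpp122pow2_iff_card_eq_12` (for `|G| ≤ 12`), `stpp211pow5_iff_card_eq_24`, `stpp122pow3_iff_card_eq_24`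
  (for `|G| ≤ 24`): **hosts iff the order is the onset**.

Mechanism: the structure theorem + the domination core of `STPP222CubeFrom46.lean` (every capped multiset of prime powers with product
`12` / `24` is dominated by `[4,3]` / `[2,2,3]`, resp. `[8,3]` / `[2,4,3]` / `[2,2,2,3]`), the tree's witnesses on `ℤ/12`, `ℤ/2 × ℤ/6`,
`ℤ/24`, `ℤ/2 × ℤ/12`, `ℤ/2 × ℤ/2 × ℤ/6` (stpp-3 gen 23, ENG2 gen 31/32) read on the seed types through the Chinese remainder theorem.

References: H. Cohn, R. Kleinberg, B. Szegedy, C. Umans, FOCS 2005 (arXiv:math/0511460), Def. 5.1.  Record: pub-omega HOME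
`pub-omega-stpp-3-g25/`.
-/

open Literature.Computability.AlgebraicComplexity Finset

namespace Summit.MatrixMultiplication.OmegaCensus

/-! ## 1. Every abelian group of order 12 / 24 contains a seed type from a short list -/

/-- COMBINATORIAL CORE, order 12 (kernel). -/
theorem allHostCoreOrder12 : ∀ E ∈ List.range' 1 12, ∀ M ∈ subMS (capList E), M.prod = 12 →
    ∃ s ∈ ([[4, 3], [2, 2, 3]] : List (List ℕ)), dom s M = true := by
  decide +kernel

/-- COMBINATORIAL CORE, order 24 (kernel). -/
theorem allHostCoreOrder24 : ∀ E ∈ List.range' 1 24, ∀ M ∈ subMS (capList E), M.prod = 24 →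
    ∃ s ∈ ([[8, 3], [2, 4, 3], [2, 2, 2, 3]] : List (List ℕ)), dom s M = true := by
  decide +kernel

/-- The structure-theorem step: a finite abelian group of order `N ≤ 45` contains an embedded seed type from any list `L` that dominates
every capped multiset of prime powers with product `N`. [folklore] -/
theorem exists_seed_emb_of_card {N : ℕ} (hN : N ≤ 45) (hN0 : 0 < N) {L : List (List ℕ)}
    (hcore : ∀ E ∈ List.range' 1 N, ∀ M ∈ subMS (capList E), M.prod = N → ∃ s ∈ L, dom s M = true)
    {G : Type*} [AddCommGroup G] [Finite G] (hG : Nat.card G = N) :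
    ∃ s ∈ L, ∃ φ : SeedType s →+ G, Function.Injective φ := by
  classical
  obtain ⟨ι, _, p, hp, e, ⟨g⟩⟩ := AddCommGroup.equiv_directSum_zmod_of_finite G
  let f : G ≃+ (Π i, ZMod (p i ^ e i)) :=
    g.trans (DirectSum.linearEquivFunOnFintype ℕ ι (fun i => ZMod (p i ^ e i))).toAddEquiv
  have hE1 : 1 ≤ AddMonoid.exponent G := Nat.pos_of_ne_zero AddMonoid.exponent_ne_zero_of_finite
  have hEle : AddMonoid.exponent G ≤ N := le_trans (Nat.le_of_dvd Nat.card_pos AddGroup.exponent_dvd_nat_card) hG.le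
  have hdvd : ∀ i, p i ^ e i ∣ AddMonoid.exponent G := fun i => by
    have hinj : Function.Injective (AddMonoidHom.single (fun j => ZMod (p j ^ e j)) i) :=
      Pi.single_injective (M := fun j => ZMod (p j ^ e j)) i
    have h1 : addOrderOf (f.symm (AddMonoidHom.single (fun j => ZMod (p j ^ e j)) i 1)) = p i ^ e i := by
      rw [AddEquiv.addOrderOf_eq, addOrderOf_injective _ hinj, ZMod.addOrderOf_one]
    rw [← h1]
    exact AddMonoid.addOrder_dvd_exponent _
  have hcardeq : Nat.card G = ∏ i, p i ^ e i := by
    rw [Nat.card_congr f.toEquiv, Nat.card_pi]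
    simp [Nat.card_zmod]
  have hq0 : ∀ i, p i ^ e i ≠ 0 := fun i => pow_ne_zero _ (hp i).ne_zero
  haveI : ∀ i, NeZero (p i ^ e i) := fun i => ⟨hq0 i⟩
  set M : Multiset ℕ := (Finset.univ.filter fun i => 0 < e i).val.map fun i => p i ^ e i with hM
  have hprodeq : M.prod = ∏ i, p i ^ e i := by
    rw [hM, ← Finset.prod_eq_multiset_prod]
    exact Finset.prod_filter_of_ne fun i _ hi => Nat.pos_of_ne_zero fun h0 => hi (by rw [h0, pow_zero])
  have hmem : ∀ a ∈ M, a ∈ ppList ∧ a ∣ AddMonoid.exponent G := by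
    intro a ha
    obtain ⟨i, hi, rfl⟩ := Multiset.mem_map.1 ha
    have hi' : 0 < e i := (Finset.mem_filter.1 hi).2
    exact ⟨pow_mem_ppList (hp i) hi' (le_trans (Nat.le_of_dvd (by omega) (hdvd i)) (le_trans hEle hN)), hdvd i⟩
  have hEI : AddMonoid.exponent G ∈ List.range' 1 N := List.mem_range'_1.2 ⟨hE1, by omega⟩
  have hEI45 : AddMonoid.exponent G ∈ List.range' 1 45 := List.mem_range'_1.2 ⟨hE1, by omega⟩
  have hprodN : M.prod = N := by rw [hprodeq, ← hcardeq, hG]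
  have hle : M ≤ capMS (capList (AddMonoid.exponent G)) :=
    le_capMS_of_prod_le45 hEI45 (fun a ha => (hmem a ha).1) (fun a ha => (hmem a ha).2) (by omega)
  obtain ⟨s, hs, hD⟩ := hcore _ hEI M (mem_subMS_of_le _ _ hle) hprodN
  obtain ⟨φ, hφ, -⟩ := exists_emb_of_dom (fun i => p i ^ e i) hq0 s _ hD
  exact ⟨s, hs, f.symm.toAddMonoidHom.comp φ, f.symm.injective.comp hφ⟩

/-! ## 2. Witnesses on the seed types (Chinese remainder transports of the tree's witnesses) -/

/-- `(2,1,1)³ ⊆ ℤ/4 × ℤ/3` (`≅ ℤ/12`). [cite: CohnKleinbergSzegedyUmans2005, Def. 5.1] -/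
theorem exists_isSTPP_211pow3_seed43 :
    ∃ A B C : Fin 3 → Finset (SeedType [4, 3]), IsSTPP A B C ∧ ∀ i, (A i).card = 2 ∧ (B i).card = 1 ∧ (C i).card = 1 :=
  exists_isSTPP_211_of_injective (ZMod.chineseRemainder (by norm_num : Nat.Coprime 4 3)).toAddEquiv.toAddMonoidHom
    (AddEquiv.injective _) exists_isSTPP_211pow3_zmod12

/-- `(1,2,2)² ⊆ ℤ/4 × ℤ/3` (`≅ ℤ/12`). [cite: CohnKleinbergSzegedyUmans2005, Def. 5.1] -/
theorem exists_isSTPP_122pow2_seed43 :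
    ∃ A B C : Fin 2 → Finset (SeedType [4, 3]), IsSTPP A B C ∧ ∀ i, (A i).card = 1 ∧ (B i).card = 2 ∧ (C i).card = 2 :=
  exists_isSTPP_122_of_injective (ZMod.chineseRemainder (by norm_num : Nat.Coprime 4 3)).toAddEquiv.toAddMonoidHom
    (AddEquiv.injective _) exists_isSTPP_122pow2_zmod12

/-- `(2,1,1)³ ⊆ ℤ/2 × ℤ/2 × ℤ/3` (`≅ ℤ/2 × ℤ/6`). [cite: CohnKleinbergSzegedyUmans2005, Def. 5.1] -/
theorem exists_isSTPP_211pow3_seed223 :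
    ∃ A B C : Fin 3 → Finset (SeedType [2, 2, 3]), IsSTPP A B C ∧ ∀ i, (A i).card = 2 ∧ (B i).card = 1 ∧ (C i).card = 1 :=
  exists_isSTPP_211_of_injective
    ((AddEquiv.refl (ZMod 2)).prodCongr (ZMod.chineseRemainder (by norm_num : Nat.Coprime 2 3)).toAddEquiv).toAddMonoidHom
    (AddEquiv.injective _) exists_isSTPP_211pow3_zmod2_zmod6

/-- `(1,2,2)² ⊆ ℤ/2 × ℤ/2 × ℤ/3` (`≅ ℤ/2 × ℤ/6`). [cite: CohnKleinbergSzegedyUmans2005, Def. 5.1] -/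
theorem exists_isSTPP_122pow2_seed223 :
    ∃ A B C : Fin 2 → Finset (SeedType [2, 2, 3]), IsSTPP A B C ∧ ∀ i, (A i).card = 1 ∧ (B i).card = 2 ∧ (C i).card = 2 :=
  exists_isSTPP_122_of_injective
    ((AddEquiv.refl (ZMod 2)).prodCongr (ZMod.chineseRemainder (by norm_num : Nat.Coprime 2 3)).toAddEquiv).toAddMonoidHom
    (AddEquiv.injective _) exists_isSTPP_122pow2_zmod2_zmod6

/-- `(2,1,1)⁵ ⊆ ℤ/8 × ℤ/3` (`≅ ℤ/24`). [cite: CohnKleinbergSzegedyUmans2005, Def. 5.1] -/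
theorem exists_isSTPP_211pow5_seed83 :
    ∃ A B C : Fin 5 → Finset (SeedType [8, 3]), IsSTPP A B C ∧ ∀ i, (A i).card = 2 ∧ (B i).card = 1 ∧ (C i).card = 1 :=
  exists_isSTPP_211_of_injective (ZMod.chineseRemainder (by norm_num : Nat.Coprime 8 3)).toAddEquiv.toAddMonoidHom
    (AddEquiv.injective _) exists_isSTPP_211pow5_zmod24

/-- `(1,2,2)³ ⊆ ℤ/8 × ℤ/3` (`≅ ℤ/24`). [cite: CohnKleinbergSzegedyUmans2005, Def. 5.1] -/
theorem exists_isSTPP_122pow3_seed83 :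
    ∃ A B C : Fin 3 → Finset (SeedType [8, 3]), IsSTPP A B C ∧ ∀ i, (A i).card = 1 ∧ (B i).card = 2 ∧ (C i).card = 2 :=
  exists_isSTPP_122_of_injective (ZMod.chineseRemainder (by norm_num : Nat.Coprime 8 3)).toAddEquiv.toAddMonoidHom
    (AddEquiv.injective _) exists_isSTPP_122pow3_zmod24

/-- `(2,1,1)⁵ ⊆ ℤ/2 × ℤ/4 × ℤ/3` (`≅ ℤ/2 × ℤ/12`). [cite: CohnKleinbergSzegedyUmans2005, Def. 5.1] -/
theorem exists_isSTPP_211pow5_seed243 :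
    ∃ A B C : Fin 5 → Finset (SeedType [2, 4, 3]), IsSTPP A B C ∧ ∀ i, (A i).card = 2 ∧ (B i).card = 1 ∧ (C i).card = 1 :=
  exists_isSTPP_211_of_injective
    ((AddEquiv.refl (ZMod 2)).prodCongr (ZMod.chineseRemainder (by norm_num : Nat.Coprime 4 3)).toAddEquiv).toAddMonoidHom
    (AddEquiv.injective _) exists_isSTPP_211pow5_zmod2_zmod12

/-- `(1,2,2)³ ⊆ ℤ/2 × ℤ/4 × ℤ/3` (`≅ ℤ/2 × ℤ/12`). [cite: CohnKleinbergSzegedyUmans2005, Def. 5.1] -/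
theorem exists_isSTPP_122pow3_seed243 :
    ∃ A B C : Fin 3 → Finset (SeedType [2, 4, 3]), IsSTPP A B C ∧ ∀ i, (A i).card = 1 ∧ (B i).card = 2 ∧ (C i).card = 2 :=
  exists_isSTPP_122_of_injective
    ((AddEquiv.refl (ZMod 2)).prodCongr (ZMod.chineseRemainder (by norm_num : Nat.Coprime 4 3)).toAddEquiv).toAddMonoidHom
    (AddEquiv.injective _) exists_isSTPP_122pow3_zmod2_zmod12

/-- `(2,1,1)⁵ ⊆ ℤ/2 × ℤ/2 × ℤ/2 × ℤ/3` (`≅ ℤ/2 × ℤ/2 × ℤ/6`). [cite: CohnKleinbergSzegedyUmans2005, Def. 5.1] -/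
theorem exists_isSTPP_211pow5_seed2223 :
    ∃ A B C : Fin 5 → Finset (SeedType [2, 2, 2, 3]), IsSTPP A B C ∧ ∀ i, (A i).card = 2 ∧ (B i).card = 1 ∧ (C i).card = 1 :=
  exists_isSTPP_211_of_injective
    ((AddEquiv.refl (ZMod 2)).prodCongr ((AddEquiv.refl (ZMod 2)).prodCongr
      (ZMod.chineseRemainder (by norm_num : Nat.Coprime 2 3)).toAddEquiv)).toAddMonoidHom
    (AddEquiv.injective _) exists_isSTPP_211pow5_zmod2_zmod2_zmod6

/-- `(1,2,2)³ ⊆ ℤ/2 × ℤ/2 × ℤ/2 × ℤ/3` (`≅ ℤ/2 × ℤ/2 × ℤ/6`). [cite: CohnKleinbergSzegedyUmans2005, Def. 5.1] -/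
theorem exists_isSTPP_122pow3_seed2223 :
    ∃ A B C : Fin 3 → Finset (SeedType [2, 2, 2, 3]), IsSTPP A B C ∧ ∀ i, (A i).card = 1 ∧ (B i).card = 2 ∧ (C i).card = 2 :=
  exists_isSTPP_122_of_injective
    ((AddEquiv.refl (ZMod 2)).prodCongr ((AddEquiv.refl (ZMod 2)).prodCongr
      (ZMod.chineseRemainder (by norm_num : Nat.Coprime 2 3)).toAddEquiv)).toAddMonoidHom
    (AddEquiv.injective _) exists_isSTPP_122pow3_zmod2_zmod2_zmod6

/-! ## 3. Every abelian group of order 12 / 24 hosts; the onsets as intrinsic equivalences -/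

/-- **Every finite abelian group of order `12` admits `(2,1,1)³`.** [cite: CohnKleinbergSzegedyUmans2005, Def. 5.1] -/
theorem exists_isSTPP_211pow3_of_card_12 {G : Type*} [AddCommGroup G] [Finite G] (hG : Nat.card G = 12) :
    ∃ A B C : Fin 3 → Finset G, IsSTPP A B C ∧ ∀ i, (A i).card = 2 ∧ (B i).card = 1 ∧ (C i).card = 1 := by
  obtain ⟨s, hs, φ, hφ⟩ := exists_seed_emb_of_card (by norm_num) (by norm_num) allHostCoreOrder12 hG
  simp only [List.mem_cons, List.mem_nil_iff, or_false] at hs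
  rcases hs with rfl | rfl
  · exact exists_isSTPP_211_of_injective φ hφ exists_isSTPP_211pow3_seed43
  · exact exists_isSTPP_211_of_injective φ hφ exists_isSTPP_211pow3_seed223

/-- **Every finite abelian group of order `12` admits `(1,2,2)²`.** [cite: CohnKleinbergSzegedyUmans2005, Def. 5.1] -/
theorem exists_isSTPP_122pow2_of_card_12 {G : Type*} [AddCommGroup G] [Finite G] (hG : Nat.card G = 12) :
    ∃ A B C : Fin 2 → Finset G, IsSTPP A B C ∧ ∀ i, (A i).card = 1 ∧ (B i).card = 2 ∧ (C i).card = 2 := by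
  obtain ⟨s, hs, φ, hφ⟩ := exists_seed_emb_of_card (by norm_num) (by norm_num) allHostCoreOrder12 hG
  simp only [List.mem_cons, List.mem_nil_iff, or_false] at hs
  rcases hs with rfl | rfl
  · exact exists_isSTPP_122_of_injective φ hφ exists_isSTPP_122pow2_seed43
  · exact exists_isSTPP_122_of_injective φ hφ exists_isSTPP_122pow2_seed223

/-- **Every finite abelian group of order `24` admits `(2,1,1)⁵`.** [cite: CohnKleinbergSzegedyUmans2005, Def. 5.1] -/
theorem exists_isSTPP_211pow5_of_card_24 {G : Type*} [AddCommGroup G] [Finite G] (hG : Nat.card G = 24) :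
    ∃ A B C : Fin 5 → Finset G, IsSTPP A B C ∧ ∀ i, (A i).card = 2 ∧ (B i).card = 1 ∧ (C i).card = 1 := by
  obtain ⟨s, hs, φ, hφ⟩ := exists_seed_emb_of_card (by norm_num) (by norm_num) allHostCoreOrder24 hG
  simp only [List.mem_cons, List.mem_nil_iff, or_false] at hs
  rcases hs with rfl | rfl | rfl
  · exact exists_isSTPP_211_of_injective φ hφ exists_isSTPP_211pow5_seed83
  · exact exists_isSTPP_211_of_injective φ hφ exists_isSTPP_211pow5_seed243
  · exact exists_isSTPP_211_of_injective φ hφ exists_isSTPP_211pow5_seed2223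

/-- **Every finite abelian group of order `24` admits `(1,2,2)³`.** [cite: CohnKleinbergSzegedyUmans2005, Def. 5.1] -/
theorem exists_isSTPP_122pow3_of_card_24 {G : Type*} [AddCommGroup G] [Finite G] (hG : Nat.card G = 24) :
    ∃ A B C : Fin 3 → Finset G, IsSTPP A B C ∧ ∀ i, (A i).card = 1 ∧ (B i).card = 2 ∧ (C i).card = 2 := by
  obtain ⟨s, hs, φ, hφ⟩ := exists_seed_emb_of_card (by norm_num) (by norm_num) allHostCoreOrder24 hG
  simp only [List.mem_cons, List.mem_nil_iff, or_false] at hs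
  rcases hs with rfl | rfl | rfl
  · exact exists_isSTPP_122_of_injective φ hφ exists_isSTPP_122pow3_seed83
  · exact exists_isSTPP_122_of_injective φ hφ exists_isSTPP_122pow3_seed243
  · exact exists_isSTPP_122_of_injective φ hφ exists_isSTPP_122pow3_seed2223

/-- **ONSET OF `(2,1,1)³` AS AN EQUIVALENCE (kernel): a finite abelian group of order `≤ 12` admits `(2,1,1)³` iff its order is `12`.**
[cite: CohnKleinbergSzegedyUmans2005, Def. 5.1] -/
theorem stpp211pow3_iff_card_eq_12 {G : Type*} [AddCommGroup G] [Finite G] (hG : Nat.card G ≤ 12) :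
    (∃ A B C : Fin 3 → Finset G, IsSTPP A B C ∧ ∀ i, (A i).card = 2 ∧ (B i).card = 1 ∧ (C i).card = 1) ↔ Nat.card G = 12 :=
  ⟨fun h => by
    by_contra hne
    exact not_exists_isSTPP_211pow3_of_card_le (by omega) h,
    fun h => exists_isSTPP_211pow3_of_card_12 h⟩

/-- **ONSET OF `(1,2,2)²` AS AN EQUIVALENCE (kernel): a finite abelian group of order `≤ 12` admits `(1,2,2)²` iff its order is `12`.**
[cite: CohnKleinbergSzegedyUmans2005, Def. 5.1] -/
theorem stpp122pow2_iff_card_eq_12 {G : Type*} [AddCommGroup G] [Finite G] (hG : Nat.card G ≤ 12) :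
    (∃ A B C : Fin 2 → Finset G, IsSTPP A B C ∧ ∀ i, (A i).card = 1 ∧ (B i).card = 2 ∧ (C i).card = 2) ↔ Nat.card G = 12 :=
  ⟨fun h => by
    by_contra hne
    exact not_exists_isSTPP_122pow2_of_card_le (by omega) h,
    fun h => exists_isSTPP_122pow2_of_card_12 h⟩

/-- **ONSET OF `(2,1,1)⁵` AS AN EQUIVALENCE (kernel): a finite abelian group of order `≤ 24` admits `(2,1,1)⁵` iff its order is `24`.**
[cite: CohnKleinbergSzegedyUmans2005, Def. 5.1] -/
theorem stpp211pow5_iff_card_eq_24 {G : Type*} [AddCommGroup G] [Finite G] (hG : Nat.card G ≤ 24) :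
    (∃ A B C : Fin 5 → Finset G, IsSTPP A B C ∧ ∀ i, (A i).card = 2 ∧ (B i).card = 1 ∧ (C i).card = 1) ↔ Nat.card G = 24 :=
  ⟨fun h => by
    by_contra hne
    exact not_exists_isSTPP_211pow5_of_card_le (by omega) h,
    fun h => exists_isSTPP_211pow5_of_card_24 h⟩

/-- **ONSET OF `(1,2,2)³` AS AN EQUIVALENCE (kernel): a finite abelian group of order `≤ 24` admits `(1,2,2)³` iff its order is `24`.**
[cite: CohnKleinbergSzegedyUmans2005, Def. 5.1] -/
theorem stpp122pow3_iff_card_eq_24 {G : Type*} [AddCommGroup G] [Finite G] (hG : Nat.card G ≤ 24) :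
    (∃ A B C : Fin 3 → Finset G, IsSTPP A B C ∧ ∀ i, (A i).card = 1 ∧ (B i).card = 2 ∧ (C i).card = 2) ↔ Nat.card G = 24 :=
  ⟨fun h => by
    by_contra hne
    exact not_exists_isSTPP_122pow3_of_card_le (by omega) h,
    fun h => exists_isSTPP_122pow3_of_card_24 h⟩

/-- **ONSET OF `(2,1,1)⁴` AND `(1,2,2)⁴` AS EQUIVALENCES — the PROPER host lists (kernel): a finite abelian group of order `≤ 16` admits
`(2,1,1)⁴` iff it has order `16` and is neither cyclic nor elementary abelian; a finite abelian group of order `≤ 32` admits `(1,2,2)⁴` iff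
it has order `32` and is neither cyclic nor elementary abelian.** [cite: CohnKleinbergSzegedyUmans2005, Def. 5.1] -/
theorem stpp_pow4_onsets_iff {G G' : Type*} [AddCommGroup G] [Finite G] [AddCommGroup G'] [Finite G'] (hG : Nat.card G ≤ 16)
    (hG' : Nat.card G' ≤ 32) :
    ((∃ A B C : Fin 4 → Finset G, IsSTPP A B C ∧ ∀ i, (A i).card = 2 ∧ (B i).card = 1 ∧ (C i).card = 1) ↔
        (Nat.card G = 16 ∧ ¬ IsAddCyclic G ∧ ¬ ∀ x : G, 2 • x = 0)) ∧
      ((∃ A B C : Fin 4 → Finset G', IsSTPP A B C ∧ ∀ i, (A i).card = 1 ∧ (B i).card = 2 ∧ (C i).card = 2) ↔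
        (Nat.card G' = 32 ∧ ¬ IsAddCyclic G' ∧ ¬ ∀ x : G', 2 • x = 0)) := by
  constructor
  · constructor
    · intro h
      have h16 : Nat.card G = 16 := by
        by_contra hne
        exact not_exists_isSTPP_211pow4_of_card_le (by omega) h
      exact ⟨h16, (stpp211pow4_order16_iff h16).1 h⟩
    · rintro ⟨h16, hrest⟩
      exact (stpp211pow4_order16_iff h16).2 hrest
  · constructor
    · intro h
      have h32 : Nat.card G' = 32 := by
        by_contra hne
        exact not_exists_isSTPP_122pow4_of_card_le_31 (by omega) h
      exact ⟨h32, (stpp122pow4_order32_iff h32).1 h⟩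
    · rintro ⟨h32, hrest⟩
      exact (stpp122pow4_order32_iff h32).2 hrest

end Summit.MatrixMultiplication.OmegaCensus
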